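/-
Copyright (c) 2026 the pub-hodgecm-mathlib formalisation cell (harness21).  Prover seat hodgecm-mathlib-K2E3-p24 (g0), Track B «K2-LIT» ∕ h413
(`stmt-HodgeConjecture-24833`), line `K2_E3_EllipticInputs`, road (11-3-split-nsc), leaf (nsc-S-C′) `sig_K2E3GL3TwoBlockCuspidalSupportCharLocInt`,
brick (vD-σ-LA): the linear algebra under van Dijk's trace formula for a NON-one-dimensional inducing datum.  2026-09-04.
-/
import Literature.LinearAlgebra.FiniteKernelOperatorTrace   -- ★ VD-1 (B-p18): `LinearMap.trace_restrict_eq_trace_of_range_le`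
import Mathlib.LinearAlgebra.StdBasis
import Mathlib.LinearAlgebra.Trace
import HarnessLib

/-!
# K2_E3 road (h413), leaf (nsc-S-C′), brick (vD-σ-LA) — the trace of a BLOCK operator on a finite product `Π_y E_y` is the sum of the traces of its
# diagonal blocks, and the trace of an operator intertwined INTO an ambient operator whose image it contains is the ambient trace

Cell `pub/hodgecm-mathlib` (D-0151), Track B, seat K2E3-p24 (g0) = hand of the hosted leaf (nsc-S-C′) (road owner K2E3-p11 (g6)).
`--supports stmt-HodgeConjecture-24833 --as helper`; THEOREMS ONLY (no definition ∕ instance ∕ notation ∕ named fact ∕ `sorry`); never imports `Cruxes/…/Lines`.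
COUNT-NEUTRAL (pure linear algebra).

THE MATHEMATICS ([Bourbaki1989LieGroups13, Ch. I §4 no. 3]; the linear-algebra heart of [vanDijk1972, Thm. p. 237] ∕ [BernsteinZelevinsky1977, §2.3] for an
inducing representation `σ` on a space `W` of dimension `> 1`).  The `K′`-fixed vectors of `Ind_H^G σ` embed (`G = H·K`) into the finite product
`Π_{y ∈ K⧸K′} W^{σ(H ∩ ỹK′ỹ⁻¹)}` of FINITE-DIMENSIONAL spaces (admissibility of `σ`), and `π(f)` is intertwined into the BLOCK operator
`(Mψ)_y = Σ_{y′} A_{y y′} ψ_{y′}` with operator-valued kernel `A_{y y′} : W_{y′} → W_y`; the image of `M` consists of equivariant tuples, i.e. lies in the image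
of the embedding.  Then `tr π(f) = tr M = Σ_y tr A_{y y}`.  This file isolates the two linear-algebra facts (the 1-dimensional case is ★ VD-1
`Literature.LinearAlgebra.trace_eq_sum_diag_of_eq_kernelOp`):
* **`trace_pi_eq_sum_trace_diag`** — for ANY endomorphism `M` of a finite product `Π_y E_y` of finite-dimensional spaces over a field,
  `tr M = Σ_y tr (proj_y ∘ M ∘ single_y)` (the diagonal blocks; matrix of `M` in the product basis `Pi.basis`).
* **`trace_eq_trace_of_comp_eq_of_range_le`** — `j : E ↪ F` injective, `F` finite-dimensional, `T ∈ End E`, `M ∈ End F` with `j ∘ T = M ∘ j` and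
  `im M ⊆ im j` ⟹ `tr T = tr M` (`M = j ∘ S`, `S ∘ j = T`, Mathlib `LinearMap.trace_comp_comm'`).

HONEST LABEL: HC_CM is proved only modulo the 7 printed citations (2 remaining named inputs: hLiu418 = stmt-HodgeConjecture-24832, h413 =
stmt-HodgeConjecture-24833) until rung 0 closes; count-neutral helper.

## References
* [Bourbaki1989LieGroups13] N. Bourbaki, *Lie Groups and Lie Algebras*, Ch. I §4 no. 3 (trace in an adapted basis).
* [vanDijk1972] G. van Dijk, *Computation of certain induced characters of 𝔭-adic groups*, Math. Ann. 199 (1972), 229–240, Thm. p. 237.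
* [BernsteinZelevinsky1977] I. N. Bernstein, A. V. Zelevinsky, *Induced representations of reductive 𝔭-adic groups I*, §2.3.
-/

set_option autoImplicit false
set_option linter.dupNamespace false

noncomputable section

open scoped BigOperators

namespace Summit.HodgeConjecture.HodgeConjecture.Cruxes.H413.K2E3PiBlockOperatorTrace

/-! ## §1  The trace of a block operator on a finite product -/

section Pi

variable {K : Type*} [Field K] {Y : Type*} [Fintype Y] [DecidableEq Y]
  {E : Y → Type*} [∀ y, AddCommGroup (E y)] [∀ y, Module K (E y)] [∀ y, FiniteDimensional K (E y)]

/-- **`tr M = Σ_y tr M_{y y}` for an endomorphism of a finite product of finite-dimensional spaces**, `M_{y y} = proj_y ∘ M ∘ single_y` the diagonal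
blocks (matrix of `M` in the product basis `Pi.basis`; the diagonal entry at `⟨y, i⟩` is the `(i,i)` entry of the matrix of `M_{y y}`).
[cite: Bourbaki1989LieGroups13, Ch. I §4 no. 3 Prop. 4] -/
theorem trace_pi_eq_sum_trace_diag (M : (Π y, E y) →ₗ[K] (Π y, E y)) :
    LinearMap.trace K (Π y, E y) M = ∑ y, LinearMap.trace K (E y) ((LinearMap.proj y) ∘ₗ M ∘ₗ (LinearMap.single K E y)) := by
  classical
  let b : ∀ y, Module.Basis (Fin (Module.finrank K (E y))) K (E y) := fun y => Module.finBasis K (E y)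
  let B := Pi.basis b
  rw [LinearMap.trace_eq_matrix_trace K B, Matrix.trace]
  simp only [Matrix.diag_apply, LinearMap.toMatrix_apply]
  rw [Fintype.sum_sigma]
  refine Finset.sum_congr rfl fun y _ => ?_
  rw [LinearMap.trace_eq_matrix_trace K (b y), Matrix.trace]
  refine Finset.sum_congr rfl fun i _ => ?_
  rw [Matrix.diag_apply, LinearMap.toMatrix_apply, Pi.basis_repr, Pi.basis_apply]
  rfl

end Pi

/-! ## §2  The trace of an operator intertwined into an ambient operator with small image -/

section Ambient

variable {K : Type*} [Field K] {E F : Type*} [AddCommGroup E] [Module K E] [AddCommGroup F] [Module K F] [FiniteDimensional K F]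

/-- **`tr T = tr M` when `j ∘ T = M ∘ j`, `j` injective and `im M ⊆ im j`** (`F` finite-dimensional; then `E` is too): `M` factors as `j ∘ S` with `S ∘ j = T`,
and `tr (S ∘ j) = tr (j ∘ S)` (Mathlib `LinearMap.trace_comp_comm'`).  The shape of van Dijk's trace computation: `E = (Ind σ)^{K′}`, `j` = restriction to
`K ⧸ K′`, `M` = the block kernel operator. [cite: Bourbaki1989LieGroups13, Ch. I §4 no. 3 Prop. 4 (d)] [cite: vanDijk1972, Thm. p. 237] -/
theorem trace_eq_trace_of_comp_eq_of_range_le (j : E →ₗ[K] F) (hj : Function.Injective j) (T : E →ₗ[K] E) (M : F →ₗ[K] F)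
    (hc : j ∘ₗ T = M ∘ₗ j) (hr : LinearMap.range M ≤ LinearMap.range j) :
    LinearMap.trace K E T = LinearMap.trace K F M := by
  haveI : FiniteDimensional K E := Module.Finite.of_injective j hj
  -- `M = j ∘ S`
  let e : E ≃ₗ[K] LinearMap.range j := LinearEquiv.ofInjective j hj
  let S : F →ₗ[K] E := e.symm.toLinearMap ∘ₗ LinearMap.codRestrict (LinearMap.range j) M fun x => hr (LinearMap.mem_range_self M x)
  have hjS : j ∘ₗ S = M := by
    refine LinearMap.ext fun x => ?_
    simp only [S, e, LinearMap.comp_apply, LinearEquiv.coe_toLinearMap, LinearEquiv.ofInjective_symm_apply, LinearMap.codRestrict_apply]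
  -- `S ∘ j = T`
  have hSj : S ∘ₗ j = T := by
    refine LinearMap.ext fun x => hj ?_
    have h1 : j (S (j x)) = M (j x) := by
      rw [← LinearMap.comp_apply j S, hjS]
    have h2 : j (T x) = M (j x) := by
      rw [← LinearMap.comp_apply j T, hc, LinearMap.comp_apply]
    rw [LinearMap.comp_apply, h1, h2]
  rw [← hSj, LinearMap.trace_comp_comm', hjS]

end Ambient

end Summit.HodgeConjecture.HodgeConjecture.Cruxes.H413.K2E3PiBlockOperatorTrace

end
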